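import Summits.CriticalPhenomena.PercolationContinuityZ3.Theorems.PercNearOneGluingNoHeavyLowerTailSwitchRelaxK4R4N2
import HarnessLib

/-!
# `NoHeavyLowerTail` (stmt-CriticalPhenomena-4575) — SPECTATOR SLICES [14] of the one-step FOUR-copy switching certificate `r4inc`
# for the generic increasing QUARTIC row `E4(U[a|b], U[a|c], U[b|y], U[c|y]) ≥ 0` on four points: data and scalable kernel checks (file N3)

Support file (prover prim-masterthm-p1 gen 3; `--supports stmt-CriticalPhenomena-4575`).  No named facts, no sorries.

SPECTATOR SLICING (prim-masterthm-p1 SCHEMA-K §10.3).  A Σ₂(4,4) certificate (copies X, Y, Z active, one spectator copy W never touched) for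
`E₄(row) ≥ 0` is the same thing as 15 THREE-copy certificates `c_q` (q = type of W) — each pointwise sound on every finite graph — whose expectations
satisfy `Σ_q P_q·E[S_q] = −16·E₄ʰᵒᵐ` in the 15 type masses.  This file transcribes slices of `r4inc` (prim-masterthm-p1 certs-g2/K4onestep-inc/,
exact integer identity + complete-enumeration verdict + realcheck) into prim-cert-2's `SwitchRelax.Cert` (pool X2: one-step words `u>Y`, `u>Z`;
types in `FourPointAtoms.pat4` order; potentials × 16) with the scalable kernel check of `…SwitchRelaxCheckN/V` (per input type: coverage `coverN` +
vectorised pair check `vecCheckN`), giving `S_q ≤ 0` pointwise (`Sreal_nonpos`, by `Cert.soundN`).  Every slice was re-verified offline in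
prim-cert-2's independent relaxation (relaxN.analyse: max 0 at all 15 input types).  The quartic identity and the measure-level theorem
`0 ≤ sahiE4 …` are in `…SwitchRelaxK4R4Measure`.
-/

namespace Summit.CriticalPhenomena.PercolationContinuityZ3.Theorems

namespace SwitchRelax

namespace K4R4

/- The kernel checks below are memory-bound; elaborating them one at a time keeps each within the farm's memory cap. -/
set_option Elab.async false
namespace S14


/-- **Slice 14 is pointwise sound**: `S ≤ 0` at every configuration triple of every finite graph. [this work] -/
theorem Sreal_nonpos {V : Type*} [Fintype V] [DecidableEq V] (τ : Fin 4 → V) (x : Fin 3 → Finset (Sym2 V)) :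
    Sreal τ K4R4.S14.cert x ≤ 0 :=
  K4R4.S14.cert.soundN τ wf_cert (K4R4.S14.cert.okAt_all
    ⟨_, _, _, _, tabOK_bucket3 ents0 0, TPb_ok, cover_0, pairOK_of_vecCheckN vec_0⟩
    ⟨_, _, _, _, tabOK_bucket3 ents0 1, TPb_ok, cover_1, pairOK_of_vecCheckN vec_1⟩
    ⟨_, _, _, _, tabOK_bucket3 ents0 2, TPb_ok, cover_2, pairOK_of_vecCheckN vec_2⟩
    ⟨_, _, _, _, tabOK_bucket3 ents0 3, TPb_ok, cover_3, pairOK_of_vecCheckN vec_3⟩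
    ⟨_, _, _, _, tabOK_bucket3 ents0 4, TPb_ok, cover_4, pairOK_of_vecCheckN vec_4⟩
    ⟨_, _, _, _, tabOK_bucket3 ents0 5, TPb_ok, cover_5, pairOK_of_vecCheckN vec_5⟩
    ⟨_, _, _, _, tabOK_bucket3 ents0 6, TPb_ok, cover_6, pairOK_of_vecCheckN vec_6⟩
    ⟨_, _, _, _, tabOK_bucket3 ents0 7, TPb_ok, cover_7, pairOK_of_vecCheckN vec_7⟩
    ⟨_, _, _, _, tabOK_bucket3 ents0 8, TPb_ok, cover_8, pairOK_of_vecCheckN vec_8⟩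
    ⟨_, _, _, _, tabOK_bucket3 ents0 9, TPb_ok, cover_9, pairOK_of_vecCheckN vec_9⟩
    ⟨_, _, _, _, tabOK_bucket3 ents0 10, TPb_ok, cover_10, pairOK_of_vecCheckN vec_10⟩
    ⟨_, _, _, _, tabOK_bucket3 ents0 11, TPb_ok, cover_11, pairOK_of_vecCheckN vec_11⟩
    ⟨_, _, _, _, tabOK_bucket3 ents0 12, TPb_ok, cover_12, pairOK_of_vecCheckN vec_12⟩
    ⟨_, _, _, _, tabOK_bucket3 ents0 13, TPb_ok, cover_13, pairOK_of_vecCheckN vec_13⟩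
    ⟨_, _, _, _, tabOK_bucket3 ents0 14, TPb_ok, cover_14, pairOK_of_vecCheckN vec_14⟩) x

end S14

end K4R4

end SwitchRelax

end Summit.CriticalPhenomena.PercolationContinuityZ3.Theorems
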